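import Mathlib
import Summits.Ventures.PercRepro2.SwOutCrossJunctionQReal
import Summits.Ventures.PercRepro2.SwOutCrossJunctionRealG

/-!
# A core-kind class point is a point of the block of its base, for ANY cross graph (blind cell
PercRepro2, night-4 g25, 2026-08-28; proofs/NIGHT4-G25.md §4)

`SwOutCrossJunctionReal` proved that the point `qOf ζ` of the cube of the base read off a
core-kind `Q`-point does not leak by putting ALL dropped vertices on one side (`p_same_side`,
which needs the cross graph connected).  The leak conditions are LOCAL: an attached vertex is
joined to `u` through red cross edges and a red u-edge, so it is `G`-connected to a vertex with
a red u-edge (`exists_red_uP_of_attE`), and along a walk of `G` the side is kept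
(`redExt_of_walk`); hence a red-side leak (an attached vertex with red outside edges, i.e. not in
the cluster of `u`, i.e. on the blue side) or a blue-side leak (the mirror) contradicts the
disjointness of the sides.  **`not_leakRX_qOf'`**, **`not_leakBX_qOf'`**, **`mem_blockX_baseX'`**:
the same statements for any cross graph — the dropped vertices may form several components.
-/

namespace Summit.Ventures.PercRepro2

namespace CrossArm

open Hull LocRows

section Link

variable {X : Type*} (G : SimpleGraph X)

end Link

variable {V : Type*} {E : Type*} [Fintype E] [DecidableEq E]

open scoped Classical

variable {ends : E → Sym2 V} {X : Type*} {U : Set V} {ξ : Config E} {l h o u : V} {p : X → V}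
  {G : SimpleGraph X} {r : X}

section Real

variable (hj : CrossJunctionQ ends U h u p G o r) (hl : l ∉ U) {ζ : Config E}
  (hζ : ζ ∈ swOutSide ends l h o U ξ) (hk : CoreKind ends U h u ζ)
include hj hl hζ hk

/-- Along a `G`-connection the red side is kept. -/
lemma CrossJunctionQ.redExt_of_reachable {i j : X} (hij : G.Reachable i j)
    (hi : p i ∈ redExt ends h u ζ) : p j ∈ redExt ends h u ζ :=
  hj.redExt_of_walk hl hζ hk hij.some hi

/-- A dropped vertex in the cluster of `u` lies on the red side. -/
lemma CrossJunctionQ.redExt_of_mem_cluster_u {i : X} (hi : p i ∈ cluster ends ζ u) :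
    p i ∈ redExt ends h u ζ := by
  rcases hj.p_side i with hs | hs
  · exact hs
  · exact absurd hi (hj.p_notMem_cluster_u_of_blueExt hl hζ hk hs)

/-- A dropped vertex outside the cluster of `u` lies on the blue side. -/
lemma CrossJunctionQ.blueExt_of_notMem_cluster_u {i : X} (hi : p i ∉ cluster ends ζ u) :
    p i ∈ blueExt ends ζ h u := by
  rcases hj.p_side i with hs | hs
  · exact absurd (hj.p_mem_cluster_u_of_redExt hl hζ hk hs) hi
  · exact hs

/-- **The point `qOf` has no red-side leak**, for any cross graph. -/
theorem CrossJunctionQ.not_leakRX_qOf' [Fintype X] [DecidableRel G.Adj] :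
    ¬ LeakRX G (qOf ends h u p G ζ) := by
  rintro ⟨-, i, hatt, hi⟩
  have hi' : p i ∉ cluster ends ζ u := by
    have : (qOf ends h u p G ζ).2.2.2.2 i = decide (p i ∈ cluster ends ζ u) := rfl
    rw [this, decide_eq_false_iff_not] at hi
    exact hi
  have hib : p i ∈ blueExt ends ζ h u := hj.blueExt_of_notMem_cluster_u hl hζ hk hi'
  obtain ⟨j, hij, hj'⟩ := exists_red_uP_of_attE G _ hatt
  have hj'' : p j ∈ cluster ends ζ u := by
    have : (qOf ends h u p G ζ).2.2.1 j = decide (p j ∈ cluster ends ζ u) := rfl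
    rw [this, decide_eq_true_eq] at hj'
    exact hj'
  exact hj.sides_disjoint hl hζ hk (p i)
    (hj.redExt_of_reachable hl hζ hk hij.symm (hj.redExt_of_mem_cluster_u hl hζ hk hj'')) hib

/-- **The point `qOf` has no blue-side leak**, for any cross graph. -/
theorem CrossJunctionQ.not_leakBX_qOf' [Fintype X] [DecidableRel G.Adj] :
    ¬ LeakBX G (qOf ends h u p G ζ) := by
  rintro ⟨-, i, hatt, hi⟩
  have hi' : p i ∈ cluster ends ζ u := by
    have : (flipXG G (qOf ends h u p G ζ)).2.2.2.2 i = !decide (p i ∈ cluster ends ζ u) := rfl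
    rw [this, Bool.not_eq_false', decide_eq_true_eq] at hi
    exact hi
  have hir : p i ∈ redExt ends h u ζ := hj.redExt_of_mem_cluster_u hl hζ hk hi'
  obtain ⟨j, hij, hj'⟩ := exists_red_uP_of_attE G _ hatt
  have hj'' : p j ∉ cluster ends ζ u := by
    have : (flipXG G (qOf ends h u p G ζ)).2.2.1 j = !decide (p j ∈ cluster ends ζ u) := rfl
    rw [this, Bool.not_eq_true', decide_eq_false_iff_not] at hj'
    exact hj'
  exact hj.sides_disjoint hl hζ hk (p j) (hj.redExt_of_reachable hl hζ hk hij hir)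
    (hj.blueExt_of_notMem_cluster_u hl hζ hk hj'')

/-- **A core-kind class point lies in the block of its base**, for any cross graph. -/
theorem CrossJunctionQ.mem_blockX_baseX' [Fintype X] [DecidableRel G.Adj] :
    ζ ∈ blockX ends h u p G (baseX ends h u p ζ) := by
  simp only [blockX, blockCX, Finset.mem_image, Finset.mem_filter, Finset.mem_univ, true_and]
  exact ⟨qOf ends h u p G ζ, ⟨hj.not_leakRX_qOf' hl hζ hk, hj.not_leakBX_qOf' hl hζ hk⟩,
    hj.crossReal_qOf hl hζ hk⟩

end Real

end CrossArm

end Summit.Ventures.PercRepro2
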